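import Literature.NumberTheory.LFunctions.Zhang2022.DetectorRecipeCollapse

/-!
# Zhang (2022), programme F-S3 (cell landau-siegel §E, seat ls-barrier-p6): Euler–Lagrange ORTHOGONALITY for the
# shift-detector recipe — one-sided AFE exponential sums are `P_b`-orthogonal to the doubly clamped mean-zero class,
# and the form SPLITS: `𝔅_b(g♭ + g⋆) = 𝔅_b(g♭) + 𝔅_b(g⋆)`

Y. Zhang, *Discrete mean estimates and the Landau–Siegel zero*, arXiv:2211.02515v1 [Zhang2022LandauSiegel] —
an unrefereed manuscript under adjudication. **WHAT THIS IS NOT: not a claim about Theorems 1–2 of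
arXiv:2211.02515, about Landau–Siegel zeros, or about Parity; nothing here asserts any claim of the manuscript.
The programme SEARCHES and TYPES; no claim about Landau–Siegel zeros, Theorems 1–2 of arXiv:2211.02515 or a
repaired Margin232 until a kernel theorem says so.**

Setting: the recipe form `𝔅_b = Det.FormDet (Det.shiftRecipe b)` of a distinct real shift triple `b` on one-sided
kinked profiles (`g(1) = 0`), its polar form `P_b = Det.FormDetPolar (shiftRecipe b)`, and the COLLAPSED formula I of
`DetectorRecipeCollapse`: `π·M_b(g,h) = m₀·Q_b(g,h) + iπ·m_s·g(0)·conj h(0) − π²·m_n·g(0)·conj ∫h` with the core form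
`Q_b = Det.shiftCore e₁ e₂ e₃` depending on `b` only through its elementary symmetric functions.

THIS FILE (the «cross term vanishes» half of the cell's LQ route to the E-010 continuum, notes
barrier/p6/RESONANT-PLANE.md §7, INBOX 2026-08-27T01:15Z/01:29Z):
* `shiftCore_eq_zero_left/right` — for a kinked `g♭` CLAMPED AT BOTH ENDS with MEAN ZERO (`g♭(0) = g♭(1) = 0`,
  `∫₀¹ g♭ = 0`) and a `C²` profile `h` whose Euler–Lagrange image
  `Λ_e h := −h″ − iπe₁h′ + π²e₂h + iπ³e₃·∫₀ˣh` is CONSTANT on `[0,1]`, both `Q_e(g♭, h) = 0` and `Q_e(h, g♭) = 0`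
  (two integrations by parts, `Det.integral_deriv_mul_conj_add`; the constant integrates against `g♭` to `0`);
* `formDetPolar_shiftRecipe_eq_zero_of_el` — hence `P_b(g♭, h) = 0` for such `g♭`, `h` with `h(1) = 0` (the apex terms
  of the collapse carry `g♭(0) = 0`, `∫g♭ = 0`), and the SPLITTING `𝔅_b(g♭ + h) = 𝔅_b(g♭) + 𝔅_b(h)`
  (`formDet_shiftRecipe_add_of_el`, by the polarisation identity `Det.formDet_add_smul`);
* `el_afeSum_const` — every AFE exponential sum `h = Σ_m γ_m e^{−iπb_m y}` (non-zero shifts) has CONSTANT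
  `Λ_b h = π²·Σ_m γ_m·Π_{i≠m} b_i` (each `b_m` is a root of `t³ − e₁t² + e₂t − e₃`, and `e₃/b_m = Π_{i≠m} b_i`), with its `KinkedProfile` bookkeeping; so
  **`formDet_shiftRecipe_add_afeSum`**: `𝔅_b(g♭ + g⋆) = 𝔅_b(g♭) + 𝔅_b(g⋆)` for every doubly clamped mean-zero kinked `g♭`
  and every ONE-SIDED AFE sum `g⋆` (`Σ_m γ_m e^{−iπb_m} = 0`).

Consequence recorded for the pipeline (`formDetPSD_iff`-shape is NOT claimed here): positivity of `𝔅_b` on all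
one-sided profiles reduces to positivity on (i) the doubly clamped mean-zero class and (ii) the 2-parameter AFE plane,
once every one-sided profile is matched at `(g(0), ∫g)` by an AFE sum — the matching determinant is the cell's
`Φ_{1/2}(b)` (`Det.re_sum_shiftW_eq`), a separate file. Elementary calculus; standard axioms; no definitions.

References: Y. Zhang, arXiv:2211.02515v1 (2022), Prop. 7.1 p. 44 with (7.19)–(7.21), §8 (8.11)–(8.23) [pp. 44–50].
[cite: Zhang2022LandauSiegel, Prop 7.1 p. 44, (8.11)–(8.12)]
-/

noncomputable section

open Complex Real ComplexConjugate Set intervalIntegral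
open _root_.MeasureTheory

namespace Literature.NumberTheory.LFunctions.Zhang2022

namespace Det

open Repair

variable {g g' h h' h'' : ℝ → ℂ}

/-! ### Calculus helpers on the kinked class -/

/-- A `C¹` profile is a kinked profile. [folklore] -/
private theorem kinkedProfile_of_isC1 (hg : IsC1OnUnitInterval g g') : KinkedProfile g g' :=
  ⟨hg.cont, fun x hx => (hg.hasDeriv x hx).hasDerivWithinAt, hg.isH1.memLp⟩

/-- The primitive `x ↦ ∫₀ˣ h` of a continuous `h` has derivative `h(x)` at interior points. [folklore] -/
private theorem hasDerivAt_primitive_unit' (hh : ContinuousOn h (Icc 0 1)) {x : ℝ} (hx : x ∈ Ioo (0:ℝ) 1) :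
    HasDerivAt (fun y => ∫ t in (0:ℝ)..y, h t) (h x) x := by
  have hint : IntervalIntegrable h volume 0 x :=
    (hh.mono (Icc_subset_Icc_right hx.2.le)).intervalIntegrable_of_Icc hx.1.le
  have hmeas : StronglyMeasurableAtFilter h (nhds x) volume :=
    ContinuousOn.stronglyMeasurableAtFilter isOpen_Ioo (hh.mono Ioo_subset_Icc_self) x hx
  have hcont : ContinuousAt h x := hh.continuousAt (Icc_mem_nhds hx.1 hx.2)
  exact intervalIntegral.integral_hasDerivAt_right hint hmeas hcont

/-- The primitive of a kinked profile is a kinked profile with that derivative. [folklore] -/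
private theorem kinkedProfile_primitive (hh : KinkedProfile h h') :
    KinkedProfile (fun x => ∫ t in (0:ℝ)..x, h t) h :=
  kinkedProfile_of_isC1 ⟨continuousOn_primitive_unit hh.cont, hh.cont,
    fun _ hx => hasDerivAt_primitive_unit' hh.cont hx⟩

/-- `⟨g, c⟩ = conj c · ∫ g` for a constant `c`. [folklore] -/
private theorem integral_mul_conj_const (g : ℝ → ℂ) (c : ℂ) :
    (∫ x in (0:ℝ)..1, g x * conj c) = conj c * ∫ x in (0:ℝ)..1, g x := by
  rw [← intervalIntegral.integral_const_mul]
  exact intervalIntegral.integral_congr fun x _ => by ring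

/-- `⟨c, g⟩ = c · conj ∫ g` for a constant `c`. [folklore] -/
private theorem integral_const_mul_conj (g : ℝ → ℂ) (c : ℂ) :
    (∫ x in (0:ℝ)..1, c * conj (g x)) = c * conj (∫ x in (0:ℝ)..1, g x) := by
  rw [intervalIntegral.integral_const_mul]
  congr 1
  simp only [intervalIntegral, map_sub, integral_conj]

/-! ### The core form against an Euler–Lagrange profile -/

/-- **`Q_e(g♭, h) = 0`**: for a kinked `g♭` clamped at both ends with mean zero and a `C²` profile `h` (`(h,h′)`, `(h′,h″)`
`C¹` on `[0,1]`) whose Euler–Lagrange image `−h″ − iπe₁h′ + π²e₂h + iπ³e₃∫₀ˣh` equals a constant `C` on `[0,1]`, the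
core form `Det.shiftCore e₁ e₂ e₃ g♭ h` vanishes. [cite: Zhang2022LandauSiegel, Prop 7.1 p. 44, (8.11)–(8.12)] -/
theorem shiftCore_eq_zero_left {e1 e2 e3 : ℝ} {C : ℂ} (hg : KinkedProfile g g') (hg0 : g 0 = 0) (hg1 : g 1 = 0)
    (hgI : ∫ x in (0:ℝ)..1, g x = 0) (hh : IsC1OnUnitInterval h h') (hh' : IsC1OnUnitInterval h' h'')
    (hel : ∀ x ∈ Icc (0:ℝ) 1,
      -h'' x - I * π * e1 * h' x + (π : ℂ) ^ 2 * e2 * h x + I * (π : ℂ) ^ 3 * e3 * ∫ t in (0:ℝ)..x, h t = C) :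
    shiftCore e1 e2 e3 g g' h h' = 0 := by
  have hgk := hg
  have hhk := kinkedProfile_of_isC1 hh
  have hh'k := kinkedProfile_of_isC1 hh'
  -- integration by parts: ⟨g′, h′⟩ = −⟨g, h″⟩
  have ibp := integral_deriv_mul_conj_add hgk hh'k
  simp only [hg0, hg1, zero_mul, sub_zero] at ibp
  -- ⟨g′,h′⟩ = -⟨g,h″⟩
  have hA : (∫ x in (0:ℝ)..1, g' x * conj (h' x)) = -∫ x in (0:ℝ)..1, g x * conj (h'' x) := by
    linear_combination ibp
  unfold shiftCore
  rw [hA, hgI, zero_mul, zero_sub]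
  -- combine the four integrals into ∫ g · conj(Λ h) = ∫ g · conj C = conj C · ∫ g = 0
  have hS : ContinuousOn (fun x => ∫ t in (0:ℝ)..x, h t) (Icc 0 1) := continuousOn_primitive_unit hh.cont
  have ci : ∀ {F : ℝ → ℂ}, ContinuousOn F (Icc 0 1) →
      IntervalIntegrable (fun x => g x * conj (F x)) volume 0 1 := fun hF =>
    (hg.cont.mul (continuousOn_conj_comp hF)).intervalIntegrable_of_Icc zero_le_one
  have i2 := ci hh'.cont'
  have i2n : IntervalIntegrable (fun x => -(g x * conj (h'' x))) volume 0 1 := i2.neg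
  have i1 := ci hh.cont'
  have i0 := ci hh.cont
  have iS := ci hS
  have key : (∫ x in (0:ℝ)..1, g x * conj C)
      = -(∫ x in (0:ℝ)..1, g x * conj (h'' x)) + I * π * e1 * (∫ x in (0:ℝ)..1, g x * conj (h' x))
        + (π : ℂ) ^ 2 * e2 * (∫ x in (0:ℝ)..1, g x * conj (h x))
        - I * (π : ℂ) ^ 3 * e3 * (∫ x in (0:ℝ)..1, g x * conj (∫ t in (0:ℝ)..x, h t)) := by
    have hcongr : (∫ x in (0:ℝ)..1, g x * conj C)
        = ∫ x in (0:ℝ)..1, (((-(g x * conj (h'' x)) + I * π * e1 * (g x * conj (h' x)))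
            + (π : ℂ) ^ 2 * e2 * (g x * conj (h x)))
            - I * (π : ℂ) ^ 3 * e3 * (g x * conj (∫ t in (0:ℝ)..x, h t))) := by
      refine intervalIntegral.integral_congr fun x hx => ?_
      rw [uIcc_of_le zero_le_one] at hx
      rw [← hel x hx]
      simp only [map_add, map_sub, map_neg, map_mul, map_pow, Complex.conj_ofReal, Complex.conj_I]
      ring
    rw [hcongr, intervalIntegral.integral_sub ((i2n.add (i1.const_mul _)).add (i0.const_mul _))
        (iS.const_mul _), intervalIntegral.integral_add (i2n.add (i1.const_mul _)) (i0.const_mul _),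
      intervalIntegral.integral_add i2n (i1.const_mul _), intervalIntegral.integral_neg,
      intervalIntegral.integral_const_mul, intervalIntegral.integral_const_mul,
      intervalIntegral.integral_const_mul]
  have hzero : (∫ x in (0:ℝ)..1, g x * conj C) = 0 := by
    rw [integral_mul_conj_const, hgI, mul_zero]
  rw [hzero] at key
  linear_combination -key

/-- **`Q_e(h, g♭) = 0`** under the same hypotheses (the other order of arguments).
[cite: Zhang2022LandauSiegel, Prop 7.1 p. 44, (8.11)–(8.12)] -/
theorem shiftCore_eq_zero_right {e1 e2 e3 : ℝ} {C : ℂ} (hg : KinkedProfile g g') (hg0 : g 0 = 0) (hg1 : g 1 = 0)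
    (hgI : ∫ x in (0:ℝ)..1, g x = 0) (hh : IsC1OnUnitInterval h h') (hh' : IsC1OnUnitInterval h' h'')
    (hel : ∀ x ∈ Icc (0:ℝ) 1,
      -h'' x - I * π * e1 * h' x + (π : ℂ) ^ 2 * e2 * h x + I * (π : ℂ) ^ 3 * e3 * ∫ t in (0:ℝ)..x, h t = C) :
    shiftCore e1 e2 e3 h h' g g' = 0 := by
  have hhk := kinkedProfile_of_isC1 hh
  have hh'k := kinkedProfile_of_isC1 hh'
  -- ⟨h′, g′⟩ = −⟨h″, g⟩
  have ibp1 := integral_deriv_mul_conj_add hh'k hg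
  simp only [hg0, hg1, map_zero, mul_zero, sub_zero] at ibp1
  -- ⟨h, g′⟩ = −⟨h′, g⟩
  have ibp2 := integral_deriv_mul_conj_add hhk hg
  simp only [hg0, hg1, map_zero, mul_zero, sub_zero] at ibp2
  -- ⟨h, S_g⟩ = −⟨S_h, g⟩  (primitives are kinked; S_h(0) = 0, S_g(1) = ∫g = 0)
  have ibp3 := integral_deriv_mul_conj_add (kinkedProfile_primitive hhk) (kinkedProfile_primitive hg)
  simp only [intervalIntegral.integral_same, hgI, map_zero, mul_zero, sub_zero] at ibp3
  have hA : (∫ x in (0:ℝ)..1, h' x * conj (g' x)) = -∫ x in (0:ℝ)..1, h'' x * conj (g x) := by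
    linear_combination ibp1
  have hB : (∫ x in (0:ℝ)..1, h x * conj (g' x)) = -∫ x in (0:ℝ)..1, h' x * conj (g x) := by
    linear_combination ibp2
  have hD : (∫ x in (0:ℝ)..1, h x * conj (∫ t in (0:ℝ)..x, g t))
      = -∫ x in (0:ℝ)..1, (∫ t in (0:ℝ)..x, h t) * conj (g x) := by
    linear_combination ibp3
  unfold shiftCore
  rw [hA, hB, hD, hgI, map_zero, mul_zero, zero_sub]
  have hS : ContinuousOn (fun x => ∫ t in (0:ℝ)..x, h t) (Icc 0 1) := continuousOn_primitive_unit hh.cont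
  have ci : ∀ {F : ℝ → ℂ}, ContinuousOn F (Icc 0 1) →
      IntervalIntegrable (fun x => F x * conj (g x)) volume 0 1 := fun hF =>
    (hF.mul (continuousOn_conj_comp hg.cont)).intervalIntegrable_of_Icc zero_le_one
  have i2 := ci hh'.cont'
  have i2n : IntervalIntegrable (fun x => -(h'' x * conj (g x))) volume 0 1 := i2.neg
  have i1 := ci hh.cont'
  have i1n : IntervalIntegrable (fun x => -(h' x * conj (g x))) volume 0 1 := i1.neg
  have i0 := ci hh.cont
  have iS := ci hS
  have key : (∫ x in (0:ℝ)..1, C * conj (g x))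
      = -(∫ x in (0:ℝ)..1, h'' x * conj (g x)) + I * π * e1 * (-(∫ x in (0:ℝ)..1, h' x * conj (g x)))
        + (π : ℂ) ^ 2 * e2 * (∫ x in (0:ℝ)..1, h x * conj (g x))
        + I * (π : ℂ) ^ 3 * e3 * (-(-(∫ x in (0:ℝ)..1, (∫ t in (0:ℝ)..x, h t) * conj (g x)))) := by
    have hcongr : (∫ x in (0:ℝ)..1, C * conj (g x))
        = ∫ x in (0:ℝ)..1, (((-(h'' x * conj (g x)) + I * π * e1 * (-(h' x * conj (g x))))
            + (π : ℂ) ^ 2 * e2 * (h x * conj (g x)))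
            + I * (π : ℂ) ^ 3 * e3 * ((∫ t in (0:ℝ)..x, h t) * conj (g x))) := by
      refine intervalIntegral.integral_congr fun x hx => ?_
      rw [uIcc_of_le zero_le_one] at hx
      rw [← hel x hx]
      ring
    rw [hcongr, intervalIntegral.integral_add ((i2n.add (i1n.const_mul _)).add (i0.const_mul _))
        (iS.const_mul _), intervalIntegral.integral_add (i2n.add (i1n.const_mul _)) (i0.const_mul _),
      intervalIntegral.integral_add i2n (i1n.const_mul _), intervalIntegral.integral_neg,
      intervalIntegral.integral_const_mul, intervalIntegral.integral_neg, intervalIntegral.integral_const_mul,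
      intervalIntegral.integral_const_mul, neg_neg]
  have hzero : (∫ x in (0:ℝ)..1, C * conj (g x)) = 0 := by
    rw [integral_const_mul_conj, hgI, map_zero, mul_zero]
  rw [hzero] at key
  linear_combination -key

/-! ### The polar recipe form and the splitting -/

variable {b : Fin 3 → ℝ}

/-- **`P_b(g♭, h) = 0`:** for a distinct triple `b`, a doubly clamped mean-zero kinked `g♭` and a one-sided `C²` profile
`h` (`h(1) = 0`) with constant Euler–Lagrange image `Λ_b h` (`e_k = symE_k b`), the polar recipe form vanishes — the
apex terms of the collapse carry the factors `g♭(0) = 0`, `∫g♭ = 0`.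
[cite: Zhang2022LandauSiegel, Prop 7.1 p. 44, (8.11)–(8.12)] -/
theorem formDetPolar_shiftRecipe_eq_zero_of_el {C : ℂ} (hb : Function.Injective b) (hg : KinkedProfile g g')
    (hg0 : g 0 = 0) (hg1 : g 1 = 0) (hgI : ∫ x in (0:ℝ)..1, g x = 0)
    (hh : IsC1OnUnitInterval h h') (hh' : IsC1OnUnitInterval h' h'') (hh1 : h 1 = 0)
    (hel : ∀ x ∈ Icc (0:ℝ) 1,
      -h'' x - I * π * (symE1 b) * h' x + (π : ℂ) ^ 2 * (symE2 b) * h x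
        + I * (π : ℂ) ^ 3 * (symE3 b) * ∫ t in (0:ℝ)..x, h t = C) :
    FormDetPolar (shiftRecipe b) g g' h h' = 0 := by
  have hhk := kinkedProfile_of_isC1 hh
  rw [← formDetPolarDD_eq_formDetPolar hb hg hhk hg1 hh1, FormDetPolarDD,
    mformDD_eq_collapse_oneSided b hg hhk hg1, mformDD_eq_collapse b,
    shiftCore_eq_zero_left hg hg0 hg1 hgI hh hh' hel, shiftCore_eq_zero_right hg hg0 hg1 hgI hh hh' hel,
    integral_deriv_mul_conj_add hhk hg, hg0, hg1, hgI]
  simp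

/-- **Splitting of the recipe form:** under the hypotheses of `formDetPolar_shiftRecipe_eq_zero_of_el`,
`𝔅_b(g♭ + h) = 𝔅_b(g♭) + 𝔅_b(h)`. [cite: Zhang2022LandauSiegel, Prop 7.1 p. 44, (8.11)–(8.12)] -/
theorem formDet_shiftRecipe_add_of_el {C : ℂ} (hb : Function.Injective b) (hg : KinkedProfile g g')
    (hg0 : g 0 = 0) (hg1 : g 1 = 0) (hgI : ∫ x in (0:ℝ)..1, g x = 0)
    (hh : IsC1OnUnitInterval h h') (hh' : IsC1OnUnitInterval h' h'') (hh1 : h 1 = 0)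
    (hel : ∀ x ∈ Icc (0:ℝ) 1,
      -h'' x - I * π * (symE1 b) * h' x + (π : ℂ) ^ 2 * (symE2 b) * h x
        + I * (π : ℂ) ^ 3 * (symE3 b) * ∫ t in (0:ℝ)..x, h t = C) :
    FormDet (shiftRecipe b) (fun x => g x + h x) (fun x => g' x + h' x)
      = FormDet (shiftRecipe b) g g' + FormDet (shiftRecipe b) h h' := by
  have hhk := kinkedProfile_of_isC1 hh
  have h1 := formDet_add_smul (R := shiftRecipe b) hg hhk 1
  simp only [one_mul, map_one, norm_one, one_pow] at h1
  rw [h1, formDetPolar_shiftRecipe_eq_zero_of_el hb hg hg0 hg1 hgI hh hh' hh1 hel]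
  simp

/-! ### AFE exponential sums are Euler–Lagrange profiles -/

/-- Derivative of `y ↦ e^{cy}`. [folklore] -/
private theorem hasDerivAt_cexp_mul (c : ℂ) (y : ℝ) :
    HasDerivAt (fun y : ℝ => cexp (c * y)) (c * cexp (c * y)) y := by
  have h1 : HasDerivAt (fun y : ℝ => c * (y : ℂ)) c y := by
    simpa using ((hasDerivAt_id y).ofReal_comp).const_mul c
  have h2 := (Complex.hasDerivAt_exp _).comp y h1
  refine h2.congr_deriv ?_
  ring

/-- The AFE frequencies `c_m = −iπb_m` and an AFE sum written out. We keep everything inline (no definitions):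
`afe(y) = Σ_m γ_m e^{c_m y}`, `afe′ = Σ_m γ_m c_m e^{c_m y}`, `afe″ = Σ_m γ_m c_m² e^{c_m y}`. Derivative of the sum.
[folklore] -/
private theorem hasDerivAt_afeSum (b : Fin 3 → ℝ) (γ : Fin 3 → ℂ) (k : ℕ) (y : ℝ) :
    HasDerivAt (fun y : ℝ => ∑ m : Fin 3, γ m * (-(I * π * (b m : ℂ))) ^ k * cexp (-(I * π * (b m : ℂ)) * y))
      (∑ m : Fin 3, γ m * (-(I * π * (b m : ℂ))) ^ (k + 1) * cexp (-(I * π * (b m : ℂ)) * y)) y := by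
  have := HasDerivAt.fun_sum (u := Finset.univ)
    (A := fun (m : Fin 3) (y : ℝ) => γ m * (-(I * π * (b m : ℂ))) ^ k * cexp (-(I * π * (b m : ℂ)) * y))
    (A' := fun m => γ m * (-(I * π * (b m : ℂ))) ^ (k + 1) * cexp (-(I * π * (b m : ℂ)) * y)) (x := y)
    (fun m _ => by
      have h := (hasDerivAt_cexp_mul (-(I * π * (b m : ℂ))) y).const_mul (γ m * (-(I * π * (b m : ℂ))) ^ k)
      refine h.congr_deriv ?_
      ring)
  simpa using this

/-- Continuity of an AFE sum (any power of the frequencies as coefficients). [folklore] -/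
private theorem continuous_afeSum (b : Fin 3 → ℝ) (γ : Fin 3 → ℂ) (k : ℕ) :
    Continuous (fun y : ℝ => ∑ m : Fin 3, γ m * (-(I * π * (b m : ℂ))) ^ k * cexp (-(I * π * (b m : ℂ)) * y)) := by
  refine continuous_finsetSum _ fun m _ => ?_
  exact continuous_const.mul (Complex.continuous_exp.comp (continuous_const.mul Complex.continuous_ofReal))

/-- An AFE sum and its derivative form a `C¹` pair on `[0,1]`. [folklore] -/
private theorem isC1_afeSum (b : Fin 3 → ℝ) (γ : Fin 3 → ℂ) (k : ℕ) :
    IsC1OnUnitInterval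
      (fun y : ℝ => ∑ m : Fin 3, γ m * (-(I * π * (b m : ℂ))) ^ k * cexp (-(I * π * (b m : ℂ)) * y))
      (fun y : ℝ => ∑ m : Fin 3, γ m * (-(I * π * (b m : ℂ))) ^ (k + 1) * cexp (-(I * π * (b m : ℂ)) * y)) :=
  ⟨(continuous_afeSum b γ k).continuousOn, (continuous_afeSum b γ (k + 1)).continuousOn,
    fun y _ => hasDerivAt_afeSum b γ k y⟩

/-- Primitive of an AFE sum with non-zero shifts: `∫₀ˣ Σ_m γ_m e^{c_m t} = Σ_m γ_m (e^{c_m x} − 1)/c_m`. [folklore] -/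
private theorem primitive_afeSum (b : Fin 3 → ℝ) (hb0 : ∀ m, b m ≠ 0) (γ : Fin 3 → ℂ) (x : ℝ) :
    (∫ t in (0:ℝ)..x, ∑ m : Fin 3, γ m * (-(I * π * (b m : ℂ))) ^ 0 * cexp (-(I * π * (b m : ℂ)) * t))
      = ∑ m : Fin 3, γ m * ((cexp (-(I * π * (b m : ℂ)) * x) - 1) / (-(I * π * (b m : ℂ)))) := by
  have hc : ∀ m, (-(I * π * (b m : ℂ))) ≠ 0 := fun m => by
    simp [hb0 m, Real.pi_ne_zero, Complex.I_ne_zero]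
  rw [intervalIntegral.integral_finsetSum (fun m _ => ?_)]
  · refine Finset.sum_congr rfl fun m _ => ?_
    rw [show (fun t : ℝ => γ m * (-(I * π * (b m : ℂ))) ^ 0 * cexp (-(I * π * (b m : ℂ)) * t))
        = fun t : ℝ => γ m * cexp (-(I * π * (b m : ℂ)) * t) by funext t; simp,
      intervalIntegral.integral_const_mul, integral_exp_mul_complex (hc m)]
    simp
  · exact ((continuous_const.mul (Complex.continuous_exp.comp
      (continuous_const.mul Complex.continuous_ofReal))).intervalIntegrable _ _)

/-- Each shift satisfies `b_m² − e₁b_m + e₂ = Π_{i≠m} b_i` (`= shiftN b m`), the node-polynomial root relation divided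
by `b_m`. [folklore] -/
private theorem nodePoly_root' (b : Fin 3 → ℝ) (m : Fin 3) :
    (b m) ^ 2 - symE1 b * b m + symE2 b - shiftN b m = 0 := by
  fin_cases m <;> simp [symE1, symE2, shiftN] <;> ring

/-- `e₃ = b_m · Π_{i≠m} b_i`. [folklore] -/
private theorem symE3_eq_mul_shiftN (b : Fin 3 → ℝ) (m : Fin 3) : symE3 b = b m * shiftN b m := by
  fin_cases m <;> simp [symE3, shiftN] <;> ring

/-- **AFE sums are Euler–Lagrange profiles:** for non-zero shifts, the AFE sum `h = Σ_m γ_m e^{−iπb_m y}` has CONSTANT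
Euler–Lagrange image `−h″ − iπe₁h′ + π²e₂h + iπ³e₃∫₀ˣh = π²·Σ_m γ_m·Π_{i≠m}b_i` (`e_k = symE_k b`): the coefficient of
`e^{−iπb_m y}` is `π²·(b_m² − e₁b_m + e₂ − e₃/b_m) = 0`. [cite: Zhang2022LandauSiegel, Prop 7.1 p. 44, (7.19)–(7.21)] -/
theorem el_afeSum_const (b : Fin 3 → ℝ) (hb0 : ∀ m, b m ≠ 0) (γ : Fin 3 → ℂ) (x : ℝ) :
    -(∑ m : Fin 3, γ m * (-(I * π * (b m : ℂ))) ^ 2 * cexp (-(I * π * (b m : ℂ)) * x))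
      - I * π * (symE1 b) * (∑ m : Fin 3, γ m * (-(I * π * (b m : ℂ))) ^ 1 * cexp (-(I * π * (b m : ℂ)) * x))
      + (π : ℂ) ^ 2 * (symE2 b) * (∑ m : Fin 3, γ m * (-(I * π * (b m : ℂ))) ^ 0 * cexp (-(I * π * (b m : ℂ)) * x))
      + I * (π : ℂ) ^ 3 * (symE3 b)
          * ∫ t in (0:ℝ)..x, ∑ m : Fin 3, γ m * (-(I * π * (b m : ℂ))) ^ 0 * cexp (-(I * π * (b m : ℂ)) * t)
      = (π : ℂ) ^ 2 * ∑ m : Fin 3, γ m * (shiftN b m : ℂ) := by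
  rw [primitive_afeSum b hb0 γ x]
  have hbC : ∀ m, (b m : ℂ) ≠ 0 := fun m => by exact_mod_cast hb0 m
  have hπ : (π : ℂ) ≠ 0 := by exact_mod_cast Real.pi_ne_zero
  have hI0 : I ≠ 0 := Complex.I_ne_zero
  -- termwise: the coefficient of `e^{c_m x}` vanishes by the node polynomial
  have term : ∀ m : Fin 3,
      -(γ m * (-(I * π * (b m : ℂ))) ^ 2 * cexp (-(I * π * (b m : ℂ)) * x))
        - I * π * (symE1 b) * (γ m * (-(I * π * (b m : ℂ))) ^ 1 * cexp (-(I * π * (b m : ℂ)) * x))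
        + (π : ℂ) ^ 2 * (symE2 b) * (γ m * (-(I * π * (b m : ℂ))) ^ 0 * cexp (-(I * π * (b m : ℂ)) * x))
        + I * (π : ℂ) ^ 3 * (symE3 b) * (γ m * ((cexp (-(I * π * (b m : ℂ)) * x) - 1) / (-(I * π * (b m : ℂ)))))
        = (π : ℂ) ^ 2 * (γ m * (shiftN b m : ℂ)) := by
    intro m
    set E : ℂ := cexp (-(I * π * (b m : ℂ)) * x) with hE
    have hroot : ((b m : ℂ)) ^ 2 - (symE1 b : ℂ) * (b m : ℂ) + (symE2 b : ℂ) - (shiftN b m : ℂ) = 0 := by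
      exact_mod_cast nodePoly_root' b m
    have he3 : (symE3 b : ℂ) = (b m : ℂ) * (shiftN b m : ℂ) := by exact_mod_cast symE3_eq_mul_shiftN b m
    have hdiv : I * (π : ℂ) ^ 3 * (symE3 b : ℂ) * (γ m * ((E - 1) / (-(I * π * (b m : ℂ)))))
        = -((π : ℂ) ^ 2 * (shiftN b m : ℂ) * γ m * (E - 1)) := by
      have hbm : (b m : ℂ) ≠ 0 := hbC m
      rw [he3]
      field_simp
    rw [hdiv]
    linear_combination ((π : ℂ) ^ 2 * γ m * E) * hroot
      + (-(γ m) * (π : ℂ) ^ 2 * (b m : ℂ) ^ 2 * E + (π : ℂ) ^ 2 * (symE1 b : ℂ) * γ m * (b m : ℂ) * E)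
        * Complex.I_sq
  rw [Finset.mul_sum, Finset.mul_sum, Finset.mul_sum, Finset.mul_sum, ← Finset.sum_neg_distrib,
    ← Finset.sum_sub_distrib, ← Finset.sum_add_distrib, ← Finset.sum_add_distrib]
  exact Finset.sum_congr rfl fun m _ => term m

/-- **The splitting for AFE sums:** for a distinct triple of non-zero shifts `b`, a doubly clamped mean-zero kinked
`g♭` and a ONE-SIDED AFE sum `g⋆ = Σ_m γ_m e^{−iπb_m y}` (`Σ_m γ_m e^{−iπb_m} = 0`),
`𝔅_b(g♭ + g⋆) = 𝔅_b(g♭) + 𝔅_b(g⋆)` — the Euler–Lagrange cross term vanishes.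
[cite: Zhang2022LandauSiegel, Prop 7.1 p. 44, (8.11)–(8.12)] -/
theorem formDet_shiftRecipe_add_afeSum (hb : Function.Injective b) (hb0 : ∀ m, b m ≠ 0)
    (hg : KinkedProfile g g') (hg0 : g 0 = 0) (hg1 : g 1 = 0) (hgI : ∫ x in (0:ℝ)..1, g x = 0)
    (γ : Fin 3 → ℂ) (hγ : ∑ m : Fin 3, γ m * cexp (-(I * π * (b m : ℂ))) = 0) :
    FormDet (shiftRecipe b)
        (fun x => g x + ∑ m : Fin 3, γ m * (-(I * π * (b m : ℂ))) ^ 0 * cexp (-(I * π * (b m : ℂ)) * x))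
        (fun x => g' x + ∑ m : Fin 3, γ m * (-(I * π * (b m : ℂ))) ^ (0 + 1) * cexp (-(I * π * (b m : ℂ)) * x))
      = FormDet (shiftRecipe b) g g'
        + FormDet (shiftRecipe b)
          (fun x => ∑ m : Fin 3, γ m * (-(I * π * (b m : ℂ))) ^ 0 * cexp (-(I * π * (b m : ℂ)) * x))
          (fun x => ∑ m : Fin 3, γ m * (-(I * π * (b m : ℂ))) ^ (0 + 1) * cexp (-(I * π * (b m : ℂ)) * x)) := by
  have h1one : (∑ m : Fin 3, γ m * (-(I * π * (b m : ℂ))) ^ 0 * cexp (-(I * π * (b m : ℂ)) * (1:ℝ))) = 0 := by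
    simpa using hγ
  refine formDet_shiftRecipe_add_of_el (C := (π : ℂ) ^ 2 * ∑ m : Fin 3, γ m * (shiftN b m : ℂ)) hb hg hg0
    hg1 hgI (isC1_afeSum b γ 0) (isC1_afeSum b γ 1) h1one fun x _ => ?_
  have := el_afeSum_const b hb0 γ x
  simpa only [zero_add, one_add_one_eq_two] using this

/-- **The polar orthogonality for AFE sums** (same hypotheses): `P_b(g♭, g⋆) = 0`.
[cite: Zhang2022LandauSiegel, Prop 7.1 p. 44, (8.11)–(8.12)] -/
theorem formDetPolar_shiftRecipe_afeSum_eq_zero (hb : Function.Injective b) (hb0 : ∀ m, b m ≠ 0)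
    (hg : KinkedProfile g g') (hg0 : g 0 = 0) (hg1 : g 1 = 0) (hgI : ∫ x in (0:ℝ)..1, g x = 0)
    (γ : Fin 3 → ℂ) (hγ : ∑ m : Fin 3, γ m * cexp (-(I * π * (b m : ℂ))) = 0) :
    FormDetPolar (shiftRecipe b) g g'
        (fun x => ∑ m : Fin 3, γ m * (-(I * π * (b m : ℂ))) ^ 0 * cexp (-(I * π * (b m : ℂ)) * x))
        (fun x => ∑ m : Fin 3, γ m * (-(I * π * (b m : ℂ))) ^ (0 + 1) * cexp (-(I * π * (b m : ℂ)) * x)) = 0 := by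
  have h1one : (∑ m : Fin 3, γ m * (-(I * π * (b m : ℂ))) ^ 0 * cexp (-(I * π * (b m : ℂ)) * (1:ℝ))) = 0 := by
    simpa using hγ
  refine formDetPolar_shiftRecipe_eq_zero_of_el (C := (π : ℂ) ^ 2 * ∑ m : Fin 3, γ m * (shiftN b m : ℂ)) hb
    hg hg0 hg1 hgI (isC1_afeSum b γ 0) (isC1_afeSum b γ 1) h1one fun x _ => ?_
  have := el_afeSum_const b hb0 γ x
  simpa only [zero_add, one_add_one_eq_two] using this

end Det

end Literature.NumberTheory.LFunctions.Zhang2022
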